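import Summits.HubbardSuperconductivity.HubbardSuperconductivity.Theorems.NodalWardXYPerturbedXYOrderReduction

/-!
# `PerturbedXYOrder` (stmt-HubbardSuperconductivity-10739) — line `schwarz-inheritance`, lead c12:
# complex stability from A-PRIORI bounds on the tilted local correlations

The open stub of the line (`stub_complexStability` ≡ the crux, `perturbedXYOrder_iff_complexStability`) asks for
`Z_K ≠ 0 ∧ ‖num_K/Z_K/L⁶‖ ≤ B` uniformly in the volume.  A low-temperature / renormalisation-group expansion does not
deliver a statement about the GLOBAL quantity `Z_K` first; its native output is a uniform bound on expectations of LOCAL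
observables in the (complex) tilted state `⟨F⟩_K := ∫ F w_J e^{W_K} / Z_K`.  This file proves that such bounds suffice, in
the weakest ("a priori") format: the bounds need only be established at kernels where `Z_K ≠ 0` is already known.

* `tb_ne_zero_of_logDeriv_bound` — a continuity lemma on `[0,1]`: a `C¹` path `f : ℝ → ℂ` with `f 0 ≠ 0` whose logarithmic
  derivative is bounded WHEREVER `f ≠ 0` (`‖f' t‖ ≤ C ‖f t‖` if `f t ≠ 0`) has no zero on `[0,1]` (first zero `t₀`; Grönwall
  for `1/f` on `[0,s]`, `s < t₀`, gives `‖f s‖ ≥ ‖f 0‖e^{-Cs}`; continuity at `t₀`).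
* `tb_hasDerivAt_Zk_ray` — `d/dt Z(tK) = ∫ w_J e^{tW_K} W_K` at every real `t` (dominated differentiation), and
  `tb_integral_deriv_eq_sum` — that derivative is `Σ_{b,b'} K(b,b') ∫ j_b j_{b'} w_J e^{W_{tK}}`, i.e. `Z(tK) · ⟨W_K⟩_{tK}`.
* `tb_Zk_ne_zero_of_tiltedCurrentBound` — hence: if along the ray `t ∈ [0,1]` the tilted pair-current expectations
  `⟨j_b j_{b'}⟩_{tK}` are bounded by `C` wherever `Z(tK) ≠ 0`, then `Z_K ≠ 0` (the logarithmic derivative of `t ↦ Z(tK)` is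
  bounded by `C Σ‖K‖`).
* `complexStability_of_tiltedCorrelationBounds` — **the reduction**: uniform a-priori bounds on the tilted pair-current
  expectations `⟨j_b j_{b'}⟩_K` and on the tilted two-point function `⟨cos(θ_x − θ_y)⟩_K` (for `J ≥ J₀`, `L ≥ 2`, `K`
  admissible at radius `ε₂`, AT KERNELS WITH `Z_K ≠ 0`) imply complex stability at the same radius with `B = C`
  (admissibility is balanced, so the whole ray `tK`, `t ∈ [0,1]`, is admissible; the plateau is an average of `L⁶` tilted
  two-point values), and `perturbedXYOrder_of_tiltedCorrelationBounds` — hence the crux (`perturbedXYOrder_of_complexStability`).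

The hypothesis of the reduction is the registered stub `stub_tiltedCorrelationBounds` of skeleton rev 12 (the T-RG deliverable
in local-observable form: "bounded analytic local expectations of the low-temperature rotator under a small complex two-current
tilt, uniformly in the volume" — Balaban–O'Carroll-shaped; unprinted for complex / power-law kernels).  Nothing here is the
missing expansion; this is format-fixing glue, sorry-free.
-/

noncomputable section

namespace Summit.HubbardSuperconductivity.HubbardSuperconductivity.Theorems.PerturbedXYOrder

open MeasureTheory Literature.Probability.LatticeModels
open Summit.HubbardSuperconductivity.HubbardSuperconductivity.Theses.NodalWardXY

/-! ### A continuity lemma: no zero is reached while the logarithmic derivative stays bounded -/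

/-- **No zero can be reached along a path on which the logarithmic derivative stays bounded.** If `f : ℝ → ℂ` is
differentiable at every point of `[0,1]`, `f 0 ≠ 0`, and `‖f' t‖ ≤ C ‖f t‖` holds at every `t ∈ [0,1]` where `f t ≠ 0`,
then `f` has no zero on `[0,1]`.  Proof: if `t₀` is the first zero, Grönwall's inequality for `1/f` on `[0,s]`, `s < t₀`
(`‖(1/f)'‖ = ‖f'‖/‖f‖² ≤ C‖1/f‖`) gives `‖f s‖ ≥ ‖f 0‖ e^{-Cs} ≥ ‖f 0‖e^{-C t₀} > 0`, contradicting continuity at `t₀`.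
[folklore] -/
theorem tb_ne_zero_of_logDeriv_bound {f f' : ℝ → ℂ} {C : ℝ}
    (hf : ∀ t ∈ Set.Icc (0:ℝ) 1, HasDerivAt f (f' t) t) (h0 : f 0 ≠ 0)
    (hb : ∀ t ∈ Set.Icc (0:ℝ) 1, f t ≠ 0 → ‖f' t‖ ≤ C * ‖f t‖) :
    ∀ t ∈ Set.Icc (0:ℝ) 1, f t ≠ 0 := by
  have hcont : ContinuousOn f (Set.Icc 0 1) := fun t ht => (hf t ht).continuousAt.continuousWithinAt
  -- replace `C` by a nonnegative constant
  set C' : ℝ := max C 0 with hC'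
  have hC'0 : 0 ≤ C' := le_max_right _ _
  have hb' : ∀ t ∈ Set.Icc (0:ℝ) 1, f t ≠ 0 → ‖f' t‖ ≤ C' * ‖f t‖ := fun t ht hne =>
    (hb t ht hne).trans (mul_le_mul_of_nonneg_right (le_max_left _ _) (norm_nonneg _))
  by_contra hcon
  push Not at hcon
  obtain ⟨t₁, ht₁, hft₁⟩ := hcon
  -- the zero set in `[0,1]` is closed and nonempty; its infimum `t₀` is the first zero
  set S : Set ℝ := Set.Icc 0 1 ∩ f ⁻¹' {0} with hS
  have hSclosed : IsClosed S := hcont.preimage_isClosed_of_isClosed isClosed_Icc isClosed_singleton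
  have hSne : S.Nonempty := ⟨t₁, ht₁, hft₁⟩
  have hSbdd : BddBelow S := ⟨0, fun t ht => ht.1.1⟩
  set t₀ : ℝ := sInf S with ht₀
  have ht₀S : t₀ ∈ S := hSclosed.csInf_mem hSne hSbdd
  have ht₀I : t₀ ∈ Set.Icc (0:ℝ) 1 := ht₀S.1
  have hft₀ : f t₀ = 0 := ht₀S.2
  have ht₀pos : 0 < t₀ := by
    rcases ht₀I.1.eq_or_lt with h | h
    · exact absurd (by rw [h]; exact hft₀) h0
    · exact h
  -- before `t₀` there is no zero
  have hne : ∀ s ∈ Set.Ico (0:ℝ) t₀, f s ≠ 0 := by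
    intro s hs hfs
    have hsS : s ∈ S := ⟨⟨hs.1, hs.2.le.trans ht₀I.2⟩, hfs⟩
    exact (not_le.mpr hs.2) (csInf_le hSbdd hsS)
  -- Grönwall for `1/f` on `[0,s]`, `s < t₀`: `‖f 0‖ e^{-C' s} ≤ ‖f s‖`
  have hlow : ∀ s ∈ Set.Ico (0:ℝ) t₀, ‖f 0‖ * Real.exp (-(C' * s)) ≤ ‖f s‖ := by
    intro s hs
    have hsub : Set.Icc 0 s ⊆ Set.Ico 0 t₀ := fun u hu => ⟨hu.1, hu.2.trans_lt hs.2⟩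
    have hsub1 : Set.Icc 0 s ⊆ Set.Icc (0:ℝ) 1 := fun u hu => ⟨hu.1, (hu.2.trans hs.2.le).trans ht₀I.2⟩
    have hg_cont : ContinuousOn (fun u => (f u)⁻¹) (Set.Icc 0 s) :=
      (hcont.mono hsub1).inv₀ fun u hu => hne u (hsub hu)
    have hg_der : ∀ u ∈ Set.Ico 0 s,
        HasDerivWithinAt (fun u => (f u)⁻¹) (-(f' u) / (f u) ^ 2) (Set.Ici u) u := by
      intro u hu
      have huI : u ∈ Set.Icc (0:ℝ) 1 := hsub1 ⟨hu.1, hu.2.le⟩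
      exact ((hf u huI).inv (hne u (hsub ⟨hu.1, hu.2.le⟩))).hasDerivWithinAt
    have hbound : ∀ u ∈ Set.Ico 0 s, ‖-(f' u) / (f u) ^ 2‖ ≤ C' * ‖(f u)⁻¹‖ + 0 := by
      intro u hu
      have huI : u ∈ Set.Icc (0:ℝ) 1 := hsub1 ⟨hu.1, hu.2.le⟩
      have hfu : f u ≠ 0 := hne u (hsub ⟨hu.1, hu.2.le⟩)
      have hpos : 0 < ‖f u‖ := norm_pos_iff.2 hfu
      rw [add_zero, norm_div, norm_neg, norm_pow, norm_inv, div_le_iff₀ (by positivity)]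
      calc ‖f' u‖ ≤ C' * ‖f u‖ := hb' u huI hfu
        _ = C' * ‖f u‖⁻¹ * ‖f u‖ ^ 2 := by field_simp
    have key := norm_le_gronwallBound_of_norm_deriv_right_le (f := fun u => (f u)⁻¹)
      (f' := fun u => -(f' u) / (f u) ^ 2) (δ := ‖(f 0)⁻¹‖) (K := C') (ε := 0) (a := 0) (b := s)
      hg_cont hg_der le_rfl hbound s ⟨hs.1, le_rfl⟩
    rw [gronwallBound_ε0, sub_zero, norm_inv, norm_inv] at key
    have hfs : 0 < ‖f s‖ := norm_pos_iff.2 (hne s hs)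
    have hf0 : 0 < ‖f 0‖ := norm_pos_iff.2 h0
    have hrhs : 0 < ‖f 0‖ * Real.exp (-(C' * s)) := mul_pos hf0 (Real.exp_pos _)
    have key' : ‖f s‖⁻¹ ≤ (‖f 0‖ * Real.exp (-(C' * s)))⁻¹ := by
      rw [mul_inv, Real.exp_neg, inv_inv]; exact key
    exact (inv_le_inv₀ hfs hrhs).1 key'
  -- contradiction with continuity at the first zero `t₀`
  set m : ℝ := ‖f 0‖ * Real.exp (-(C' * t₀)) with hm
  have hm0 : 0 < m := mul_pos (norm_pos_iff.2 h0) (Real.exp_pos _)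
  have hcont₀ : ContinuousWithinAt f (Set.Icc 0 1) t₀ := hcont t₀ ht₀I
  rw [Metric.continuousWithinAt_iff] at hcont₀
  obtain ⟨δ, hδ, hδf⟩ := hcont₀ (m / 2) (half_pos hm0)
  set s : ℝ := max 0 (t₀ - δ / 2) with hs
  have hs0 : 0 ≤ s := le_max_left _ _
  have hst : s < t₀ := max_lt ht₀pos (by linarith)
  have hsI : s ∈ Set.Icc (0:ℝ) 1 := ⟨hs0, hst.le.trans ht₀I.2⟩
  have hdist : dist s t₀ < δ := by
    rw [Real.dist_eq, abs_sub_comm, abs_of_nonneg (by linarith)]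
    have : t₀ - δ / 2 ≤ s := le_max_right _ _
    linarith
  have h1 : ‖f s‖ < m / 2 := by
    have := hδf hsI hdist
    rwa [hft₀, dist_zero_right] at this
  have h2 : m ≤ ‖f s‖ := by
    refine le_trans ?_ (hlow s ⟨hs0, hst⟩)
    refine mul_le_mul_of_nonneg_left (Real.exp_le_exp.2 ?_) (norm_nonneg _)
    exact neg_le_neg (mul_le_mul_of_nonneg_left hst.le hC'0)
  linarith

/-! ### The derivative of `t ↦ Z(tK)` is `Z(tK)·⟨W_K⟩_{tK}` -/

/-- **Differentiation under the integral sign (generic, at every point).** On a finite measure space, for bounded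
a.e.-strongly measurable `g, W : α → ℂ`, `t ↦ ∫ g · exp(t W)` has derivative `∫ g · exp(t₀ W) · W` at every `t₀ ∈ ℂ`
(dominated derivative on the unit ball around `t₀`, `hasDerivAt_integral_of_dominated_loc_of_deriv_le`; the pattern of
`ent_differentiable_integral_mul_cexp`, which records only differentiability). [folklore] -/
theorem tb_hasDerivAt_integral_mul_cexp {α : Type*} [MeasurableSpace α] {μ : Measure α}
    [IsFiniteMeasure μ] {g W : α → ℂ} (hg : AEStronglyMeasurable g μ)
    (hW : AEStronglyMeasurable W μ) {G M : ℝ} (hgb : ∀ a, ‖g a‖ ≤ G) (hWb : ∀ a, ‖W a‖ ≤ M) (t₀ : ℂ) :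
    HasDerivAt (fun t : ℂ => ∫ a, g a * Complex.exp (t * W a) ∂μ)
      (∫ a, g a * (Complex.exp (t₀ * W a) * W a) ∂μ) t₀ := by
  have hmeas : ∀ t : ℂ, AEStronglyMeasurable (fun a => g a * Complex.exp (t * W a)) μ := fun t =>
    hg.mul (Complex.continuous_exp.comp_aestronglyMeasurable (hW.const_mul t))
  have hmeas' : ∀ t : ℂ, AEStronglyMeasurable (fun a => g a * (Complex.exp (t * W a) * W a)) μ :=
    fun t => hg.mul ((Complex.continuous_exp.comp_aestronglyMeasurable (hW.const_mul t)).mul hW)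
  have hexp : ∀ (t : ℂ) (R : ℝ), ‖t‖ ≤ R → ∀ a, ‖Complex.exp (t * W a)‖ ≤ Real.exp (R * M) := by
    intro t R htR a
    have hM0 : 0 ≤ M := (norm_nonneg _).trans (hWb a)
    refine (Complex.norm_exp_le_exp_norm _).trans (Real.exp_le_exp.2 ?_)
    rw [norm_mul]
    exact mul_le_mul htR (hWb a) (norm_nonneg _) ((norm_nonneg _).trans htR)
  have hbd : ∀ (t : ℂ) (R : ℝ), ‖t‖ ≤ R → ∀ a,
      ‖g a * (Complex.exp (t * W a) * W a)‖ ≤ G * (Real.exp (R * M) * M) := by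
    intro t R htR a
    have hG0 : 0 ≤ G := (norm_nonneg _).trans (hgb a)
    rw [norm_mul, norm_mul]
    exact mul_le_mul (hgb a) (mul_le_mul (hexp t R htR a) (hWb a) (norm_nonneg _) (Real.exp_nonneg _))
      (by positivity) hG0
  have key := hasDerivAt_integral_of_dominated_loc_of_deriv_le
    (F := fun t a => g a * Complex.exp (t * W a)) (F' := fun t a => g a * (Complex.exp (t * W a) * W a))
    (x₀ := t₀) (bound := fun _ => G * (Real.exp ((‖t₀‖ + 1) * M) * M)) (s := Metric.ball t₀ 1) (μ := μ)
    (Metric.ball_mem_nhds t₀ one_pos) (Filter.Eventually.of_forall hmeas) ?_ (hmeas' t₀) ?_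
    (integrable_const _) ?_
  · exact key.2
  · refine Integrable.of_bound (hmeas t₀) (G * Real.exp (‖t₀‖ * M)) (ae_of_all _ fun a => ?_)
    have hG0 : 0 ≤ G := (norm_nonneg _).trans (hgb a)
    rw [norm_mul]
    exact mul_le_mul (hgb a) (hexp t₀ ‖t₀‖ le_rfl a) (norm_nonneg _) hG0
  · refine ae_of_all _ fun a t ht => hbd t (‖t₀‖ + 1) ?_ a
    have h1 : ‖t - t₀‖ < 1 := by rwa [Metric.mem_ball, dist_eq_norm] at ht
    have h2 : ‖t‖ - ‖t₀‖ ≤ ‖t - t₀‖ := norm_sub_norm_le t t₀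
    linarith
  · exact ae_of_all _ fun a t _ => ((hasDerivAt_mul_const (W a)).cexp).const_mul (g a)

variable {L : ℕ}

/-- The bond currents are continuous in the angle field. -/
theorem tb_continuous_cur (b : Bond L) : Continuous fun θ : TorusSite 3 L → ℝ => (cur b θ : ℂ) := by
  unfold cur; fun_prop

/-- `d/dt Z(tK) = ∫ w_J e^{t W_K} W_K` at every real `t` (the complex derivative of `tb_hasDerivAt_integral_mul_cexp`
restricted to the real line by `HasDerivAt.comp_ofReal`, with `W_{tK} = t W_K`). -/
theorem tb_hasDerivAt_Zk_ray [NeZero L] (J : ℝ) (K : Bond L → Bond L → ℂ) (t : ℝ) :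
    HasDerivAt (fun s : ℝ => Zk J ((s : ℂ) • K))
      (∫ θ in cube L, wJ J θ * (Complex.exp ((t : ℂ) * Wk K θ) * Wk K θ)) t := by
  haveI := ent_isFiniteMeasure_restrict_cube (L := L)
  have hwJ : AEStronglyMeasurable (wJ (L := L) J) (volume.restrict (cube L)) :=
    (ent_continuous_wJ J).aestronglyMeasurable
  have hWk : AEStronglyMeasurable (Wk K) (volume.restrict (cube L)) :=
    (ent_continuous_Wk K).aestronglyMeasurable
  have hZfun : (fun s : ℝ => Zk J ((s : ℂ) • K)) =
      fun s : ℝ => (fun z : ℂ => ∫ θ, wJ J θ * Complex.exp (z * Wk K θ) ∂(volume.restrict (cube L))) (s : ℂ) := by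
    funext s; unfold Zk; simp_rw [ent_Wk_smul]
  rw [hZfun]
  exact (tb_hasDerivAt_integral_mul_cexp hwJ hWk (ent_norm_wJ_le J) (ent_norm_Wk_le K) (t : ℂ)).comp_ofReal

/-- The derivative integrand, expanded: `∫ w_J e^{sW_K} W_K = Σ_{b,b'} K(b,b') ∫ j_b j_{b'} w_J e^{W_{sK}}`
(finite sums and constants out of the integral; every term is continuous on the compact cube). -/
theorem tb_integral_deriv_eq_sum [NeZero L] (J : ℝ) (K : Bond L → Bond L → ℂ) (s : ℂ) :
    ∫ θ in cube L, wJ J θ * (Complex.exp (s * Wk K θ) * Wk K θ) =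
      ∑ b : Bond L, ∑ b' : Bond L, K b b' *
        ∫ θ in cube L, (cur b θ : ℂ) * (cur b' θ : ℂ) * (wJ J θ * Complex.exp (Wk (s • K) θ)) := by
  have hpt : ∀ θ : TorusSite 3 L → ℝ, wJ J θ * (Complex.exp (s * Wk K θ) * Wk K θ) =
      ∑ b : Bond L, ∑ b' : Bond L,
        K b b' * ((cur b θ : ℂ) * (cur b' θ : ℂ) * (wJ J θ * Complex.exp (Wk (s • K) θ))) := by
    intro θ
    rw [ent_Wk_smul]
    generalize Complex.exp (s * Wk K θ) = E
    simp only [Wk, Finset.mul_sum]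
    refine Finset.sum_congr rfl fun b _ => Finset.sum_congr rfl fun b' _ => ?_
    ring
  simp_rw [hpt]
  have hint : ∀ b b' : Bond L, Integrable (fun θ : TorusSite 3 L → ℝ =>
      K b b' * ((cur b θ : ℂ) * (cur b' θ : ℂ) * (wJ J θ * Complex.exp (Wk (s • K) θ))))
      (volume.restrict (cube L)) := by
    intro b b'
    have hc : Continuous fun θ : TorusSite 3 L → ℝ =>
        K b b' * ((cur b θ : ℂ) * (cur b' θ : ℂ) * (wJ J θ * Complex.exp (Wk (s • K) θ))) :=
      continuous_const.mul (((tb_continuous_cur b).mul (tb_continuous_cur b')).mul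
        ((ent_continuous_wJ J).mul (Complex.continuous_exp.comp (ent_continuous_Wk (s • K)))))
    exact hc.continuousOn.integrableOn_compact ent_isCompact_cube
  rw [integral_finsetSum _ fun b _ => integrable_finsetSum _ fun b' _ => hint b b']
  refine Finset.sum_congr rfl fun b _ => ?_
  rw [integral_finsetSum _ fun b' _ => hint b b']
  refine Finset.sum_congr rfl fun b' _ => ?_
  exact integral_const_mul _ _

/-- `Z_0 ≠ 0` (the real partition function is positive). -/
theorem tb_Zk_zero_ne_zero [NeZero L] (J : ℝ) : Zk J (0 : Bond L → Bond L → ℂ) ≠ 0 := by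
  rw [even_Zk_zero_eq, Ne, Complex.ofReal_eq_zero]
  exact (integral_xyWeight_pos (L := L) J).ne'

/-- **Zero-freeness from an a-priori bound on the tilted pair currents along the ray.** Fix `J, L, K`. If for every
`t ∈ [0,1]` at which `Z(tK) ≠ 0` the tilted pair-current expectations `⟨j_b j_{b'}⟩_{tK} = ∫ j_b j_{b'} w_J e^{W_{tK}} / Z(tK)`
are bounded in norm by `C` (all bond pairs), then `Z_K ≠ 0`: the logarithmic derivative of `t ↦ Z(tK)` is
`⟨W_K⟩_{tK} = Σ K(b,b')⟨j_b j_{b'}⟩_{tK}`, of norm `≤ C Σ‖K(b,b')‖` wherever defined, and `Z(0) = Z_0 > 0`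
(`tb_ne_zero_of_logDeriv_bound`). -/
theorem tb_Zk_ne_zero_of_tiltedCurrentBound [NeZero L] (J : ℝ) (K : Bond L → Bond L → ℂ) {C : ℝ}
    (h : ∀ t : ℝ, t ∈ Set.Icc (0:ℝ) 1 → Zk J ((t : ℂ) • K) ≠ 0 → ∀ b b' : Bond L,
      ‖(∫ θ in cube L, (cur b θ : ℂ) * (cur b' θ : ℂ) * (wJ J θ * Complex.exp (Wk ((t : ℂ) • K) θ))) /
          Zk J ((t : ℂ) • K)‖ ≤ C) :
    Zk J K ≠ 0 := by
  have key := tb_ne_zero_of_logDeriv_bound (f := fun s : ℝ => Zk J ((s : ℂ) • K))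
    (f' := fun t : ℝ => ∫ θ in cube L, wJ J θ * (Complex.exp ((t : ℂ) * Wk K θ) * Wk K θ))
    (C := C * ∑ b : Bond L, ∑ b' : Bond L, ‖K b b'‖)
    (fun t _ => tb_hasDerivAt_Zk_ray J K t) (by simpa using tb_Zk_zero_ne_zero (L := L) J) ?_
  · simpa using key 1 ⟨zero_le_one, le_rfl⟩
  intro t ht hZ
  have hZ' : Zk J ((t : ℂ) • K) ≠ 0 := hZ
  rw [tb_integral_deriv_eq_sum]
  -- each term is `K(b,b') · ⟨j_b j_b'⟩_{tK} · Z(tK)`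
  have hterm : ∀ b b' : Bond L,
      ‖K b b' * ∫ θ in cube L, (cur b θ : ℂ) * (cur b' θ : ℂ) * (wJ J θ * Complex.exp (Wk ((t : ℂ) • K) θ))‖ ≤
        ‖K b b'‖ * C * ‖Zk J ((t : ℂ) • K)‖ := by
    intro b b'
    set I := ∫ θ in cube L, (cur b θ : ℂ) * (cur b' θ : ℂ) * (wJ J θ * Complex.exp (Wk ((t : ℂ) • K) θ)) with hI
    have hIeq : I = (I / Zk J ((t : ℂ) • K)) * Zk J ((t : ℂ) • K) := (div_mul_cancel₀ I hZ').symm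
    rw [norm_mul, hIeq, norm_mul, ← mul_assoc]
    gcongr
    · exact h t ht hZ' b b'
  calc ‖∑ b : Bond L, ∑ b' : Bond L, K b b' *
          ∫ θ in cube L, (cur b θ : ℂ) * (cur b' θ : ℂ) * (wJ J θ * Complex.exp (Wk ((t : ℂ) • K) θ))‖
      ≤ ∑ b : Bond L, ∑ b' : Bond L, ‖K b b'‖ * C * ‖Zk J ((t : ℂ) • K)‖ := by
        refine (norm_sum_le _ _).trans (Finset.sum_le_sum fun b _ => ?_)
        exact (norm_sum_le _ _).trans (Finset.sum_le_sum fun b' _ => hterm b b')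
    _ = (C * ∑ b : Bond L, ∑ b' : Bond L, ‖K b b'‖) * ‖Zk J ((t : ℂ) • K)‖ := by
        rw [Finset.mul_sum, Finset.sum_mul]
        refine Finset.sum_congr rfl fun b _ => ?_
        rw [Finset.mul_sum, Finset.sum_mul]
        refine Finset.sum_congr rfl fun b' _ => ?_
        ring

/-! ### The reduction: a-priori tilted correlation bounds ⇒ complex stability ⇒ the crux -/

/-- Admissibility is balanced: the ray `tK`, `t ∈ [0,1]`, of an admissible kernel is admissible (same radius). -/
theorem tb_admissible_real_ray [NeZero L] {ε : ℝ} (hε : 0 ≤ ε) {K : Bond L → Bond L → ℂ}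
    (hK : Admissible L ε K) {t : ℝ} (ht : t ∈ Set.Icc (0:ℝ) 1) : Admissible L ε ((t : ℂ) • K) := by
  refine sch_admissible_smul ?_ hK
  have : ‖(t : ℂ)‖ ≤ 1 := by
    rw [Complex.norm_real, Real.norm_eq_abs, abs_of_nonneg ht.1]; exact ht.2
  exact mul_le_of_le_one_left hε this

/-- `|𝕋_L|² = L⁶` as real numbers (for the plateau average). -/
theorem tb_card_sq [NeZero L] : ((Fintype.card (TorusSite 3 L) : ℝ)) ^ 2 = (L : ℝ) ^ 6 := by
  rw [Fintype.card_fun, ZMod.card, Fintype.card_fin]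
  push_cast
  ring

/-- **Complex stability from a-priori bounds on the tilted local correlations.** Suppose there are `J₀`, `ε₂ > 0`, `C > 0`
such that for `J ≥ J₀`, `L ≥ 2` and every kernel `K` admissible at radius `ε₂` WITH `Z_K ≠ 0`, the tilted state
`⟨F⟩_K = ∫ F w_J e^{W_K} / Z_K` satisfies `‖⟨j_b j_{b'}⟩_K‖ ≤ C` for all bond pairs and `‖⟨cos(θ_x − θ_y)⟩_K‖ ≤ C` for all
site pairs.  Then complex stability holds at radius `ε₂` with `B = C`: `Z_K ≠ 0` by `tb_Zk_ne_zero_of_tiltedCurrentBound` along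
the admissible ray `tK` (`tb_admissible_real_ray`), and `‖num_K/Z_K/L⁶‖ = ‖L⁻⁶ Σ_{x,y} ⟨cos(θ_x − θ_y)⟩_K‖ ≤ C`. -/
theorem complexStability_of_tiltedCorrelationBounds
    (h : ∃ J₀ ε₂ C : ℝ, 0 < ε₂ ∧ 0 < C ∧ ∀ J : ℝ, J₀ ≤ J → ∀ (L : ℕ) [NeZero L], 2 ≤ L →
      ∀ K : Bond L → Bond L → ℂ, Admissible L ε₂ K → Zk J K ≠ 0 →
        (∀ b b' : Bond L,
          ‖(∫ θ in cube L, (cur b θ : ℂ) * (cur b' θ : ℂ) * (wJ J θ * Complex.exp (Wk K θ))) / Zk J K‖ ≤ C) ∧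
        (∀ x y : TorusSite 3 L,
          ‖(∫ θ in cube L, (Real.cos (θ x - θ y) : ℂ) * (wJ J θ * Complex.exp (Wk K θ))) / Zk J K‖ ≤ C)) :
    ∃ J₀ ε₂ B : ℝ, 0 < ε₂ ∧ 0 < B ∧ ∀ J : ℝ, J₀ ≤ J → ∀ (L : ℕ) [NeZero L], 2 ≤ L →
      ∀ K : Bond L → Bond L → ℂ, Admissible L ε₂ K → Zk J K ≠ 0 ∧ ‖cratio L J K‖ ≤ B := by
  obtain ⟨J₀, ε₂, C, hε₂, hC, hmain⟩ := h
  refine ⟨J₀, ε₂, C, hε₂, hC, fun J hJ L _ hL K hK => ?_⟩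
  -- zero-freeness along the ray
  have hZ : Zk J K ≠ 0 := by
    refine tb_Zk_ne_zero_of_tiltedCurrentBound J K (C := C) fun t ht hZt b b' => ?_
    exact ((hmain J hJ L hL ((t : ℂ) • K) (tb_admissible_real_ray hε₂.le hK ht) hZt).1) b b'
  refine ⟨hZ, ?_⟩
  -- the plateau is an average of `L⁶` tilted two-point values
  have htwo := (hmain J hJ L hL K hK hZ).2
  have hL0 : (0 : ℝ) < (L : ℝ) := by exact_mod_cast (lt_of_lt_of_le (by norm_num) hL : 0 < L)
  have hnum : num J K / Zk J K = ∑ x : TorusSite 3 L, ∑ y : TorusSite 3 L,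
      (∫ θ in cube L, (Real.cos (θ x - θ y) : ℂ) * (wJ J θ * Complex.exp (Wk K θ))) / Zk J K := by
    unfold num
    rw [Finset.sum_div]
    refine Finset.sum_congr rfl fun x _ => ?_
    rw [Finset.sum_div]
  have hbound : ‖num J K / Zk J K‖ ≤ (L : ℝ) ^ 6 * C := by
    rw [hnum]
    calc ‖∑ x : TorusSite 3 L, ∑ y : TorusSite 3 L,
            (∫ θ in cube L, (Real.cos (θ x - θ y) : ℂ) * (wJ J θ * Complex.exp (Wk K θ))) / Zk J K‖
        ≤ ∑ _x : TorusSite 3 L, ∑ _y : TorusSite 3 L, C := by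
          refine (norm_sum_le _ _).trans (Finset.sum_le_sum fun x _ => ?_)
          exact (norm_sum_le _ _).trans (Finset.sum_le_sum fun y _ => htwo x y)
      _ = ((Fintype.card (TorusSite 3 L) : ℝ)) ^ 2 * C := by
          simp only [Finset.sum_const, Finset.card_univ, nsmul_eq_mul]
          ring
      _ = (L : ℝ) ^ 6 * C := by rw [tb_card_sq]
  unfold cratio
  rw [norm_div, norm_pow, Complex.norm_natCast, div_le_iff₀ (by positivity)]
  linarith [hbound]

/-- STUB `stub_complexStabilityOfTiltedBounds` of the line `schwarz-inheritance` (skeleton rev 12), verbatim: **complex stability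
from a-priori bounds on the tilted local correlations** (= `complexStability_of_tiltedCorrelationBounds`). [folklore] -/
theorem stub_complexStabilityOfTiltedBounds :
    (∃ J₀ ε₂ C : ℝ, 0 < ε₂ ∧ 0 < C ∧ ∀ J : ℝ, J₀ ≤ J → ∀ (L : ℕ) [NeZero L], 2 ≤ L →
      ∀ K : Bond L → Bond L → ℂ, Admissible L ε₂ K → Zk J K ≠ 0 →
        (∀ b b' : Bond L,
          ‖(∫ θ in cube L, (cur b θ : ℂ) * (cur b' θ : ℂ) * (wJ J θ * Complex.exp (Wk K θ))) / Zk J K‖ ≤ C) ∧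
        (∀ x y : TorusSite 3 L,
          ‖(∫ θ in cube L, (Real.cos (θ x - θ y) : ℂ) * (wJ J θ * Complex.exp (Wk K θ))) / Zk J K‖ ≤ C)) →
    ∃ J₀ ε₂ B : ℝ, 0 < ε₂ ∧ 0 < B ∧ ∀ J : ℝ, J₀ ≤ J → ∀ (L : ℕ) [NeZero L], 2 ≤ L →
      ∀ K : Bond L → Bond L → ℂ, Admissible L ε₂ K → Zk J K ≠ 0 ∧ ‖cratio L J K‖ ≤ B :=
  fun h => complexStability_of_tiltedCorrelationBounds h

/-- **The crux from a-priori bounds on the tilted local correlations** (`complexStability_of_tiltedCorrelationBounds` followed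
by the landed `perturbedXYOrder_of_complexStability`, p86213). This is how `PerturbedXYOrder` closes once the registered stub
`stub_tiltedCorrelationBounds` of the line `schwarz-inheritance` (skeleton rev 12) is proved. -/
theorem perturbedXYOrder_of_tiltedCorrelationBounds
    (h : ∃ J₀ ε₂ C : ℝ, 0 < ε₂ ∧ 0 < C ∧ ∀ J : ℝ, J₀ ≤ J → ∀ (L : ℕ) [NeZero L], 2 ≤ L →
      ∀ K : Bond L → Bond L → ℂ, Admissible L ε₂ K → Zk J K ≠ 0 →
        (∀ b b' : Bond L,
          ‖(∫ θ in cube L, (cur b θ : ℂ) * (cur b' θ : ℂ) * (wJ J θ * Complex.exp (Wk K θ))) / Zk J K‖ ≤ C) ∧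
        (∀ x y : TorusSite 3 L,
          ‖(∫ θ in cube L, (Real.cos (θ x - θ y) : ℂ) * (wJ J θ * Complex.exp (Wk K θ))) / Zk J K‖ ≤ C)) :
    PerturbedXYOrder :=
  perturbedXYOrder_of_complexStability (complexStability_of_tiltedCorrelationBounds h)

end Summit.HubbardSuperconductivity.HubbardSuperconductivity.Theorems.PerturbedXYOrder

end
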